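import Literature.AlgebraicGeometry.Pohlmann1968.NondegenerateCMTypeDivisorClasses
import Literature.NumberTheory.ComplexMultiplication.CMTypeRankCharacters
import HarnessLib

/-!
# Kubota's character formula for an abelian CM field: `rank(K; Φ) = 1 + #{χ ∈ Gal(K/ℚ)^∨ odd : Σ_{σ∈Φ} χ(σ) ≠ 0}`

Number-field dress of `NumberTheory/ComplexMultiplication/CMTypeRankCharacters` (T. Kubota, Trans. AMS 118 (1965),
Lemma 2, p. 119 = B. B. Gordon, *A survey of the Hodge conjecture for abelian varieties*, Prop. 9.4.1, PROVED there for
a finite commutative group acting on itself) on the carriers of `Pohlmann1968/NondegenerateCMTypeDivisorClasses`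
(`cmTypeRank Φ` = Kubota–Dodson rank of `Φ : Motives.CMType K`, computed with `Aut(ℂ)` acting on `Hom(K, ℂ)`):

> "LEMMA 2. Let `(F; {σᵢ})` be a CM-type such that `F/ℚ` is an abelian extension. Denote by `G` the Galois group of
> `F/ℚ`, and by `ρ ∈ G` the complex conjugation of `F`. Then, the defect of `(F; {σᵢ})` is equal to the number of
> characters `ψ` of `G` satisfying `Σᵢ ψ(σᵢ) = 0`, `ψ(ρ) = −1`."  (held text
> `paper:doi-10-1090-s0002-9947-1965-0190144-8`, p0007 L13–L16; Gordon p0025 L58–L65: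
> "`rank(K,S) = 1 + #{χ : Gal(K/ℚ) → ℂ : χ(c) = −1 & Σ_{s∈S} χ(s) ≠ 0}`".)

## Dictionary and what is proved (theorems only; no named fact, no `sorry`)

For `K` a CM field, NORMAL over `ℚ` with COMMUTATIVE Galois group `G = K ≃ₐ[ℚ] K` (hypothesis `hcomm`), a base
embedding `φ₀ : K → ℂ` identifies `G` with `Hom(K, ℂ)` by `g ↦ σ_g = φ₀ ∘ g⁻¹` (`embOf`, a bijection:
`embOf_bijective`); under it `Aut(ℂ)` acts through `Gal(K/ℚ)` by translation (`smul_embOf_of_comp`,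
`exists_algEquiv_comp_eq_smul`, `exists_ringEquiv_comp_eq_algEquiv`) and
the type `Φ` becomes the set `{g | σ_g ∈ Φ}` of Kubota's `σᵢ`.  Then:

* `cmTypeRank_eq_typeRank_gal` — `rank(K; Φ)` (tree: `Aut(ℂ)` on `Hom(K, ℂ)`) equals the rank of `{g | σ_g ∈ Φ} ⊆ G`
  for `G` acting on itself (transport of the translate span along `embOf`; `typeRank_eq_of_equiv`, abstract).
* `cmTypeRank_eq_one_add_ncard_oddCharacters` — **Kubota's Lemma 2 / Gordon 9.4.1 for the field `K`**:
  `rank(K; Φ) = 1 + #{χ : Gal(K/ℚ) → ℂˣ | χ(ρ) = −1, Σ_{g : σ_g ∈ Φ} χ(g) ≠ 0}`, `ρ ∈ G` the complex conjugation of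
  `K` (any `ρ` with `φ₀ ∘ ρ = conj ∘ φ₀`, e.g. Mathlib's `NumberField.IsCMField.complexConj`; `isCMTypeWith_gal`);
  `isNondegenerate_iff_forall_oddCharacters` — `Φ` is nondegenerate iff NO odd character vanishes on it, through
  `two_mul_ncard_oddCharacters_eq_card` (half the characters are odd) and the abstract
  `IsCMTypeWith.typeRank_eq_iff_forall_oddCharacters` (dot-notation extension declared here with its absolute name).

NOT here: non-abelian Galois CM fields; the dictionary with the exponent sets of cyclotomic fields
(`Pohlmann1968/DegenerateCMTypesRibetLenstraSerre`, where degeneracy is certified by Pohlmann sets instead).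

## Sources

* T. Kubota, Trans. AMS 118 (1965) [Kubota1965] (held), §4 Lemma 2 (p. 119).
* B. B. Gordon, *A survey of the Hodge conjecture for abelian varieties* [Gordon1999HodgeAVSurvey] (held), Prop. 9.4.1.
* G. Shimura, *Abelian Varieties with Complex Multiplication and Modular Functions* (1998) [Shimura1998], §18.2
  Lemma (complex conjugation commutes with all embeddings of a CM field), §8.1 (Galois action on embeddings).
-/

noncomputable section

open NumberField

namespace Literature.AlgebraicGeometry.Pohlmann1968

open Literature.NumberTheory.ComplexMultiplication
open Literature.AlgebraicGeometry.Motives (CMType)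

open scoped Classical

/-! ### Half the characters are odd -/

section OddCharacters

open AddChar

variable {G : Type*} [CommGroup G] [Fintype G] {ρ : G}

omit [Fintype G] in
/-- `χ(ρ) = ±1` for an involution `ρ`. [folklore] -/
private theorem apply_rho_eq_or (hρ2 : ρ * ρ = 1) (χ : AddChar (Additive G) ℂ) :
    χ (Additive.ofMul ρ) = 1 ∨ χ (Additive.ofMul ρ) = -1 := by
  have h1 : χ (Additive.ofMul ρ) * χ (Additive.ofMul ρ) = 1 := by
    rw [← map_add_eq_mul, ← ofMul_mul, hρ2, ofMul_one, map_zero_eq_one]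
  exact mul_self_eq_one_iff.1 h1

/-- **Exactly half of the characters of `G` are odd** (`χ(ρ) = −1`) for an involution `ρ ≠ 1`: translation by one
odd character exchanges even and odd characters (Kubota: "let `ψ₁, …, ψ_m` be all characters of `G` which take `−1`
at `ρ`", `|G| = 2m`). [cite: Kubota1965, §4 Lemma 2 (proof)] -/
theorem two_mul_ncard_oddCharacters_eq_card (hρ1 : ρ ≠ 1) (hρ2 : ρ * ρ = 1) :
    2 * {χ : AddChar (Additive G) ℂ | χ (Additive.ofMul ρ) = -1}.ncard = Fintype.card G := by
  classical
  have hρ0 : Additive.ofMul ρ ≠ 0 := fun h => hρ1 (by simpa using congrArg Additive.toMul h)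
  obtain ⟨ψ, hψ⟩ := (AddChar.exists_apply_ne_zero (α := Additive G)).2 hρ0
  have hψ' : ψ (Additive.ofMul ρ) = -1 := (apply_rho_eq_or hρ2 ψ).resolve_left hψ
  set Odd : Set (AddChar (Additive G) ℂ) := {χ | χ (Additive.ofMul ρ) = -1} with hOdd
  set Even : Set (AddChar (Additive G) ℂ) := {χ | χ (Additive.ofMul ρ) = 1} with hEven
  have himage : (fun χ => χ + ψ) '' Even = Odd := by
    ext χ
    simp only [Set.mem_image, hEven, hOdd, Set.mem_setOf_eq]
    constructor
    · rintro ⟨χ', hχ', rfl⟩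
      rw [AddChar.add_apply, hχ', hψ', one_mul]
    · intro hχ
      refine ⟨χ - ψ, ?_, sub_add_cancel χ ψ⟩
      rw [AddChar.sub_apply', hχ, hψ']
      norm_num
  have hcardeq : Even.ncard = Odd.ncard := by
    rw [← himage, Set.ncard_image_of_injective _ (add_left_injective ψ)]
  have hunion : Even ∪ Odd = Set.univ := by
    ext χ
    simp only [Set.mem_union, hEven, hOdd, Set.mem_setOf_eq, Set.mem_univ, iff_true]
    exact apply_rho_eq_or hρ2 χ
  have hdisj : Disjoint Even Odd := by
    rw [Set.disjoint_left]
    intro χ h1 h2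
    rw [hEven, Set.mem_setOf_eq] at h1
    rw [hOdd, Set.mem_setOf_eq, h1] at h2
    norm_num at h2
  have htot : Even.ncard + Odd.ncard = Fintype.card G := by
    rw [← Set.ncard_union_eq hdisj (Set.toFinite _) (Set.toFinite _), hunion, Set.ncard_univ,
      Nat.card_eq_fintype_card, AddChar.card_eq]
    exact Fintype.card_congr Additive.toMul
  omega

/-- **Nondegeneracy ⟺ no odd character vanishes on the type** (Kubota's Lemma 2 in its qualitative form: the defect
is `0` iff no `ψ` with `ψ(ρ) = −1` has `Σᵢ ψ(σᵢ) = 0`). [cite: Kubota1965, §4 Lemma 2] -/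
theorem _root_.Literature.NumberTheory.ComplexMultiplication.IsCMTypeWith.typeRank_eq_iff_forall_oddCharacters
    [DecidableEq G] {Φ : Finset G}
    (h : IsCMTypeWith ρ (Φ : Set G)) :
    typeRank G (Φ : Set G) = Fintype.card G / 2 + 1 ↔
      ∀ χ : AddChar (Additive G) ℂ, χ (Additive.ofMul ρ) = -1 → ∑ s ∈ Φ, χ (Additive.ofMul s) ≠ 0 := by
  have hρ1 : ρ ≠ 1 := by
    intro hρ
    have := h.rho_smul_ne (1 : G)
    rw [hρ, smul_eq_mul, one_mul] at this
    exact this rfl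
  have hρ2 : ρ * ρ = 1 := by
    have := h.invol (1 : G)
    simpa [smul_eq_mul] using this
  have hdef := h.typeRank_add_ncard_oddCharacters_vanishing
  have hhalf := two_mul_ncard_oddCharacters_eq_card hρ1 hρ2
  have hvan : {χ : AddChar (Additive G) ℂ | χ (Additive.ofMul ρ) = -1 ∧ ∑ s ∈ Φ, χ (Additive.ofMul s) = 0}.ncard = 0 ↔
      ∀ χ : AddChar (Additive G) ℂ, χ (Additive.ofMul ρ) = -1 → ∑ s ∈ Φ, χ (Additive.ofMul s) ≠ 0 := by
    rw [Set.ncard_eq_zero (Set.toFinite _), Set.eq_empty_iff_forall_notMem]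
    simp only [Set.mem_setOf_eq, not_and]
  rw [← hvan]
  omega

end OddCharacters

/-! ### Transport of the rank along a bijection matching the translates -/

section Transport

variable {G : Type*} [Group G] {E : Type*} [MulAction G E]
variable {G' : Type*} [Group G'] {E' : Type*} [MulAction G' E']

/-- **The rank only depends on the set of translates**: if a bijection `e : E' ≃ E` carries the family of translates
of `Φ ⊆ E` under `G` onto the family of translates of `e⁻¹Φ ⊆ E'` under `G'` (each translate of one is a translate of
the other), then `rank_G(Φ) = rank_{G'}(e⁻¹Φ)` (precomposition with `e` is a linear isomorphism `ℚ^E ≅ ℚ^{E'}`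
matching the spanning sets). [cite: Kubota1965, §2 (p. 115)] -/
theorem typeRank_eq_of_equiv (e : E' ≃ E) (Φ : Set E)
    (h₁ : ∀ g : G, ∃ g' : G', ∀ x' : E', (g • e x' ∈ Φ ↔ g' • x' ∈ e ⁻¹' Φ))
    (h₂ : ∀ g' : G', ∃ g : G, ∀ x' : E', (g • e x' ∈ Φ ↔ g' • x' ∈ e ⁻¹' Φ)) :
    typeRank G Φ = typeRank G' (e ⁻¹' Φ) := by
  let L : (E → ℚ) ≃ₗ[ℚ] (E' → ℚ) := LinearEquiv.funCongrLeft ℚ ℚ e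
  have hL : ∀ (f : E → ℚ) (x' : E'), L f x' = f (e x') := fun f x' => rfl
  -- `L` carries each translate vector of `Φ` to a translate vector of `e⁻¹Φ` and conversely
  have hkey : ∀ (g : G) (g' : G'), (∀ x' : E', (g • e x' ∈ Φ ↔ g' • x' ∈ e ⁻¹' Φ)) →
      L (translateInd Φ g) = translateInd (e ⁻¹' Φ) g' := by
    intro g g' hgg'
    funext x'
    rw [hL]
    by_cases hx : g • e x' ∈ Φ
    · rw [translateInd_of_mem hx, translateInd_of_mem ((hgg' x').1 hx)]
    · rw [translateInd_of_not_mem hx, translateInd_of_not_mem (fun h => hx ((hgg' x').2 h))]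
  have himage : L '' Set.range (fun g : G => translateInd Φ g) = Set.range fun g' : G' => translateInd (e ⁻¹' Φ) g' := by
    ext f
    simp only [Set.mem_image, Set.mem_range, exists_exists_eq_and]
    constructor
    · rintro ⟨g, rfl⟩
      obtain ⟨g', hg'⟩ := h₁ g
      exact ⟨g', (hkey g g' hg').symm⟩
    · rintro ⟨g', rfl⟩
      obtain ⟨g, hg⟩ := h₂ g'
      exact ⟨g, hkey g g' hg⟩
  rw [typeRank, typeRank, ← himage]
  have hmap : (Submodule.span ℚ (Set.range fun g : G => translateInd Φ g)).map
      (L : (E → ℚ) →ₗ[ℚ] (E' → ℚ)) = Submodule.span ℚ (L '' Set.range fun g : G => translateInd Φ g) := by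
    rw [Submodule.map_span]
    simp only [LinearEquiv.coe_coe]
  rw [← hmap]
  exact (L.submoduleMap _).finrank_eq

end Transport

/-! ### The Galois group of a normal CM field as the torsor of its complex embeddings -/

section Galois

variable {K : Type} [Field K] [NumberField K]

/-- The embedding `σ_g = φ₀ ∘ g⁻¹` attached to `g ∈ Gal(K/ℚ)` and a base embedding `φ₀` (Shimura's indexing of the
embeddings of a Galois CM field by its Galois group). [cite: Shimura1998, §8.1] -/
def embOf (φ₀ : K →+* ℂ) (g : K ≃ₐ[ℚ] K) : K →+* ℂ := φ₀.comp g.symm.toRingEquiv.toRingHom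

/-- `σ_g(x) = φ₀(g⁻¹ x)`. [cite: Shimura1998, §8.1] -/
theorem embOf_apply (φ₀ : K →+* ℂ) (g : K ≃ₐ[ℚ] K) (x : K) : embOf φ₀ g x = φ₀ (g.symm x) := rfl

/-- Every embedding factors through the base one by a Galois automorphism (`K/ℚ` normal): `φ₁ = φ₀ ∘ γ`.
[cite: Shimura1998, §8.1] -/
theorem exists_algEquiv_comp_eq [Normal ℚ K] (φ₀ φ₁ : K →+* ℂ) : ∃ γ : K ≃ₐ[ℚ] K, ∀ x, φ₀ (γ x) = φ₁ x := by
  letI : Algebra K ℂ := φ₀.toAlgebra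
  haveI : IsScalarTower ℚ K ℂ := IsScalarTower.of_algebraMap_eq fun q => (map_ratCast φ₀ q).symm
  refine ⟨(φ₁.toRatAlgHom).restrictNormal' K, fun x => ?_⟩
  have h := (φ₁.toRatAlgHom).restrictNormal_commutes K x
  rw [Algebra.algebraMap_self, RingHom.id_apply, RingHom.toRatAlgHom_apply] at h
  exact h

/-- `g ↦ σ_g` is a bijection `Gal(K/ℚ) ≃ Hom(K, ℂ)` (`K/ℚ` normal). [cite: Shimura1998, §8.1] -/
theorem embOf_bijective [Normal ℚ K] (φ₀ : K →+* ℂ) : Function.Bijective (embOf φ₀) := by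
  constructor
  · intro g₁ g₂ h
    have h' : g₁.symm = g₂.symm := by
      apply AlgEquiv.ext
      intro x
      apply φ₀.injective
      have := congrArg (fun φ : K →+* ℂ => φ x) h
      simpa [embOf_apply] using this
    simpa using congrArg AlgEquiv.symm h'
  · intro φ
    obtain ⟨γ, hγ⟩ := exists_algEquiv_comp_eq φ₀ φ
    refine ⟨γ.symm, RingHom.ext fun x => ?_⟩
    rw [embOf_apply, AlgEquiv.symm_symm, hγ]

/-- **`Aut(ℂ)` acts on the embeddings through `Gal(K/ℚ)`**: if `τ ∘ φ₀ = φ₀ ∘ δ` (`τ ∈ Aut(ℂ)`, `δ ∈ Gal(K/ℚ)`)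
then `τ ∘ σ_g = σ_{gδ⁻¹}` for all `g`. [cite: Shimura1998, §8.1] -/
theorem smul_embOf_of_comp (φ₀ : K →+* ℂ) {τ : ℂ ≃+* ℂ} {δ : K ≃ₐ[ℚ] K} (hδ : ∀ x, τ (φ₀ x) = φ₀ (δ x))
    (g : K ≃ₐ[ℚ] K) : τ • embOf φ₀ g = embOf φ₀ (g * δ⁻¹) := by
  refine RingHom.ext fun x => ?_
  change τ (embOf φ₀ g x) = embOf φ₀ (g * δ⁻¹) x
  have h1 : (g * δ⁻¹).symm x = δ (g.symm x) := by
    change (g * δ⁻¹)⁻¹ x = δ (g⁻¹ x)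
    rw [mul_inv_rev, inv_inv, AlgEquiv.mul_apply]
  rw [embOf_apply, embOf_apply, h1, hδ]

/-- For every `τ ∈ Aut(ℂ)` there is `γ ∈ Gal(K/ℚ)` with `τ ∘ φ₀ = φ₀ ∘ γ` (`K/ℚ` normal). [cite: Shimura1998, §8.1] -/
theorem exists_algEquiv_comp_eq_smul [Normal ℚ K] (φ₀ : K →+* ℂ) (τ : ℂ ≃+* ℂ) :
    ∃ γ : K ≃ₐ[ℚ] K, ∀ x, τ (φ₀ x) = φ₀ (γ x) := by
  obtain ⟨γ, hγ⟩ := exists_algEquiv_comp_eq φ₀ ((τ : ℂ →+* ℂ).comp φ₀)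
  exact ⟨γ, fun x => (hγ x).symm⟩

/-- A number field is countable. [folklore] -/
private theorem countable_numberField : Countable K :=
  Countable.of_equiv _ (Module.finBasis ℚ K).equivFun.toEquiv.symm

/-- For every `δ ∈ Gal(K/ℚ)` there is `τ ∈ Aut(ℂ)` with `τ ∘ φ₀ = φ₀ ∘ δ` (automorphisms of a countable subfield
extend to `ℂ`; tree `Motives.ZarhinLie.exists_ringEquiv_complex_comp_eq`). [cite: Shimura1998, §8.1] -/
theorem exists_ringEquiv_comp_eq_algEquiv (φ₀ : K →+* ℂ) (δ : K ≃ₐ[ℚ] K) :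
    ∃ τ : ℂ ≃+* ℂ, ∀ x, τ (φ₀ x) = φ₀ (δ x) := by
  haveI := countable_numberField (K := K)
  obtain ⟨τ, hτ⟩ := Motives.ZarhinLie.exists_ringEquiv_complex_comp_eq φ₀ (φ₀.comp δ.toRingEquiv.toRingHom)
  exact ⟨τ, fun x => hτ x⟩

/-- **The rank of `(K; Φ)` computed on the Galois group.**  For `K/ℚ` normal with COMMUTATIVE Galois group,
`cmTypeRank Φ` (translates under `Aut(ℂ)` of `Φ ⊆ Hom(K, ℂ)`) equals the rank of the set `{g | σ_g ∈ Φ} ⊆ Gal(K/ℚ)`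
under translation (Kubota's setting: "`F/ℚ` is an abelian extension … `G` the Galois group"): `τ ∈ Aut(ℂ)` with
`τ ∘ φ₀ = φ₀ ∘ γ` acts on `σ_g = φ₀ ∘ g⁻¹` as `g ↦ gγ⁻¹ = γ⁻¹g`. [cite: Kubota1965, §4 Lemma 2] -/
theorem cmTypeRank_eq_typeRank_gal [Normal ℚ K] (hcomm : ∀ g h : K ≃ₐ[ℚ] K, g * h = h * g) (Φ : CMType K)
    (φ₀ : K →+* ℂ) : cmTypeRank Φ = typeRank (K ≃ₐ[ℚ] K) {g : K ≃ₐ[ℚ] K | embOf φ₀ g ∈ Φ.1} := by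
  let e : (K ≃ₐ[ℚ] K) ≃ (K →+* ℂ) := Equiv.ofBijective (embOf φ₀) (embOf_bijective φ₀)
  have he : ∀ g, e g = embOf φ₀ g := fun g => rfl
  have hpre : e ⁻¹' Φ.1 = {g : K ≃ₐ[ℚ] K | embOf φ₀ g ∈ Φ.1} := rfl
  rw [cmTypeRank, ← hpre]
  refine typeRank_eq_of_equiv e Φ.1 (fun τ => ?_) (fun g' => ?_)
  · obtain ⟨γ, hγ⟩ := exists_algEquiv_comp_eq_smul φ₀ τ
    refine ⟨γ⁻¹, fun x' => ?_⟩
    rw [Set.mem_preimage, he, he, smul_embOf_of_comp φ₀ hγ, smul_eq_mul, hcomm]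
  · obtain ⟨τ, hτ⟩ := exists_ringEquiv_comp_eq_algEquiv φ₀ g'⁻¹
    refine ⟨τ, fun x' => ?_⟩
    rw [Set.mem_preimage, he, he, smul_embOf_of_comp φ₀ hτ, inv_inv, smul_eq_mul, hcomm]

/-- **The type read on the Galois group is a CM type for the complex conjugation `ρ ∈ Gal(K/ℚ)`**
(`φ₀ ∘ ρ = conj ∘ φ₀`; for a CM field `ρ` is central and independent of `φ₀`, Shimura §18.2 Lemma):
`σ_{ρg} = σ̄_g`. [cite: Shimura1998, §18.2 Lemma (i)] -/
theorem isCMTypeWith_gal (hcomm : ∀ g h : K ≃ₐ[ℚ] K, g * h = h * g) (Φ : CMType K) (φ₀ : K →+* ℂ)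
    (ρ : K ≃ₐ[ℚ] K) (hρ : ∀ x, φ₀ (ρ x) = starRingEnd ℂ (φ₀ x)) :
    IsCMTypeWith ρ {g : K ≃ₐ[ℚ] K | embOf φ₀ g ∈ Φ.1} := by
  -- `ρ² = 1`
  have hρρ : ρ * ρ = 1 := by
    apply AlgEquiv.ext
    intro x
    apply φ₀.injective
    rw [AlgEquiv.mul_apply, hρ, hρ, starRingEnd_self_apply, AlgEquiv.one_apply]
  have hρinv : ρ⁻¹ = ρ := by
    rw [inv_eq_iff_mul_eq_one, hρρ]
  -- `conj ∘ σ_g = σ_{gρ⁻¹} = σ_{ρg}`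
  have hconj : ∀ g : K ≃ₐ[ℚ] K, ComplexEmbedding.conjugate (embOf φ₀ g) = embOf φ₀ (ρ * g) := by
    intro g
    have h := smul_embOf_of_comp φ₀ (τ := starRingAut) (δ := ρ) (fun x => (hρ x).symm) g
    rw [conj_smul_eq_conjugate] at h
    rw [h, hρinv, hcomm]
  refine ⟨fun g => ?_, fun g x => ?_, fun x => ?_⟩
  · change embOf φ₀ g ∈ Φ.1 ↔ embOf φ₀ (ρ * g) ∉ Φ.1
    rw [← hconj]
    exact Φ.2 _
  · change g * (ρ * x) = ρ * (g * x)
    rw [← mul_assoc, hcomm g ρ, mul_assoc]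
  · change ρ * (ρ * x) = x
    rw [← mul_assoc, hρρ, one_mul]

/-- **Kubota's Lemma 2 / Gordon Prop. 9.4.1 for a normal CM field with abelian Galois group**: with `σ_g = φ₀ ∘ g⁻¹`
and `ρ ∈ Gal(K/ℚ)` the complex conjugation,
`rank(K; Φ) = 1 + #{χ : Gal(K/ℚ) → ℂˣ | χ(ρ) = −1 and Σ_{g : σ_g ∈ Φ} χ(g) ≠ 0}` — "the defect of `(F; {σᵢ})` is
equal to the number of characters `ψ` of `G` satisfying `Σᵢ ψ(σᵢ) = 0`, `ψ(ρ) = −1`".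
[cite: Kubota1965, §4 Lemma 2] [cite: Gordon1999HodgeAVSurvey, §9.4.1 (Proposition [B.60])] -/
theorem cmTypeRank_eq_one_add_ncard_oddCharacters [Normal ℚ K] (hcomm : ∀ g h : K ≃ₐ[ℚ] K, g * h = h * g)
    (Φ : CMType K) (φ₀ : K →+* ℂ) (ρ : K ≃ₐ[ℚ] K) (hρ : ∀ x, φ₀ (ρ x) = starRingEnd ℂ (φ₀ x)) :
    cmTypeRank Φ = 1 + {χ : AddChar (Additive (K ≃ₐ[ℚ] K)) ℂ | χ (Additive.ofMul ρ) = -1 ∧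
        ∑ g ∈ Finset.univ.filter (fun g : K ≃ₐ[ℚ] K => embOf φ₀ g ∈ Φ.1), χ (Additive.ofMul g) ≠ 0}.ncard := by
  letI : CommGroup (K ≃ₐ[ℚ] K) := { (inferInstance : Group (K ≃ₐ[ℚ] K)) with mul_comm := hcomm }
  rw [cmTypeRank_eq_typeRank_gal hcomm Φ φ₀]
  have hset : ({g : K ≃ₐ[ℚ] K | embOf φ₀ g ∈ Φ.1} : Set (K ≃ₐ[ℚ] K)) =
      ↑(Finset.univ.filter fun g : K ≃ₐ[ℚ] K => embOf φ₀ g ∈ Φ.1) := by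
    ext g; simp
  have hcm := isCMTypeWith_gal hcomm Φ φ₀ ρ hρ
  rw [hset] at hcm ⊢
  exact hcm.typeRank_eq_one_add_ncard_oddCharacters

/-- **Nondegeneracy test (Kubota / Ribet)**: `(K; Φ)` is nondegenerate iff NO odd character of `Gal(K/ℚ)` vanishes on
`{g | σ_g ∈ Φ}` — the criterion by which the degenerate types of Gordon 9.4.2 were found ("exhibiting odd characters
`χ` such that `Σ_{s∈S} χ(s) = 0`"). [cite: Kubota1965, §4 Lemma 2] [cite: Gordon1999HodgeAVSurvey, §9.4.2] -/
theorem isNondegenerate_iff_forall_oddCharacters [Normal ℚ K]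
    (hcomm : ∀ g h : K ≃ₐ[ℚ] K, g * h = h * g) (Φ : CMType K) (φ₀ : K →+* ℂ) (ρ : K ≃ₐ[ℚ] K)
    (hρ : ∀ x, φ₀ (ρ x) = starRingEnd ℂ (φ₀ x)) :
    IsNondegenerate Φ ↔ ∀ χ : AddChar (Additive (K ≃ₐ[ℚ] K)) ℂ, χ (Additive.ofMul ρ) = -1 →
      ∑ g ∈ Finset.univ.filter (fun g : K ≃ₐ[ℚ] K => embOf φ₀ g ∈ Φ.1), χ (Additive.ofMul g) ≠ 0 := by
  letI : CommGroup (K ≃ₐ[ℚ] K) := { (inferInstance : Group (K ≃ₐ[ℚ] K)) with mul_comm := hcomm }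
  have hset : ({g : K ≃ₐ[ℚ] K | embOf φ₀ g ∈ Φ.1} : Set (K ≃ₐ[ℚ] K)) =
      ↑(Finset.univ.filter fun g : K ≃ₐ[ℚ] K => embOf φ₀ g ∈ Φ.1) := by
    ext g; simp
  have hcm := isCMTypeWith_gal hcomm Φ φ₀ ρ hρ
  rw [hset] at hcm
  have hcardG : Fintype.card (K ≃ₐ[ℚ] K) = Module.finrank ℚ K := by
    rw [Fintype.card_congr (Equiv.ofBijective (embOf φ₀) (embOf_bijective φ₀))]
    exact NumberField.Embeddings.card K ℂ
  rw [isNondegenerate_iff, cmTypeRank_eq_typeRank_gal hcomm Φ φ₀, hset, ← hcardG]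
  exact hcm.typeRank_eq_iff_forall_oddCharacters

end Galois

end Literature.AlgebraicGeometry.Pohlmann1968

end
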